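import Summits.ValiantsHypothesis.ValiantsHypothesis.Theorems.LacunarySymmetroidMatrixDescartesPivotRankOneCriticalWindowsTurning

/-!
# `MatrixDescartes` census — rank-one `(2,4)₁`, the e-free exponent profile: END VALUES ON THE `1|3` SPLIT
# (`E > e` near `0⁺` and near `∞` when one letter lies below the pivot — the parity input of the turning-point count)

HONEST FRAMING.  Object-search cell `pub-symmetroid`, seat `val-sym-mdr-p1` (generation 27); helper file `--supports` the crux item
stmt-ValiantsHypothesis-18050 (`Theses.LacunarySymmetroid.MatrixDescartes`, OPEN, on HOLD) with NO closure claim.  `…CriticalWindowsTurning`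
(generation 26) bounds the positive determinant roots of every rank-one hyperbolic row by `2 + #turning points` of ONE e-free profile
`E(x) = (∑ dₖWₖ(T̂ − tₖ)²)/(∑ Wₖ(T̂ − tₖ)²)`, `Wₖ = wₖx^{dₖ}`, `A T̂² = C`.  THIS FILE supplies the END VALUES of `E` on the `1|3` split of
the `(2,4)₁` cell (four letters, `d₀ < e < d₁ ≤ d₂ < d₃`; letters `0, 1` non-parallel at the lower end, `2, 3` at the upper end): the
SIGNED DENT SUM `∑ (dₖ − e)Wₖ(T̂ − tₖ)²` — whose sign is the sign of `E − e` — is POSITIVE for all small `x > 0` (`signedDent_pos_near_zero`: the dent of letter `1` beats the dent of letter `0`,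
because `T̂ → t₀` at rate `x^{d₁−d₀}`) and for all large `x` (`signedDent_pos_near_infty`: the dent of letter `2` beats letter `0`, because
`T̂ → t₃`), with explicit thresholds; hence `e < E(x)` at both ends (`profile_gt_near_zero`, `profile_gt_near_infty`).  These are the two
facts that turn the Rolle count `#{E = e} ≤ #turning points + 1` into `≤ #turning points` when that number is even (the level `e` is left
and re-entered from above), i.e. the located picture «`E′` has ≤ 6 positive zeros ⇒ `Z₊ ≤ 7` on `1|3`» of the seat memos; the counting step
itself is not in this file.  Nothing here bears on `MatrixDescartes` in its window, on `DoorA26` / `DoorA34`, registers / credences, or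
`VP ≠ VNP`.

[folklore] Elementary real inequalities (`abs`, `sq_sub_sq`, `pow_le_pow_of_le_one_left`-type monotonicity of powers); tree
`…Turning.optDir_pos_sq`, `…Turning.dent_pos`.  No definitions, no named facts.
-/

-- `Summit.ValiantsHypothesis.ValiantsHypothesis.…` repeats a component by the D-0017 layout
-- (single-conjunct summit), which the `dupNamespace` linter flags; the name is mandated.
set_option linter.dupNamespace false

namespace Summit.ValiantsHypothesis.ValiantsHypothesis.Theorems.LacunarySymmetroidMatrixDescartes.Pivot.CriticalWindows.TurningEnds

open Finset
open scoped BigOperators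
open Summit.ValiantsHypothesis.ValiantsHypothesis.Theorems.LacunarySymmetroidMatrixDescartes.Pivot.CriticalWindows.Turning
  (optDir_pos_sq dent_pos)

/-! ## 0. Three elementary inequalities -/

/-- Deviation of the optimal direction from a reference position: if `(W₀+W₁+W₂+W₃)·τ² = Σ Wₖsₖ²` with non-negative weights then
`(W₀+W₁+W₂+W₃)·|τ² − s₀²| ≤ W₁|s₁² − s₀²| + W₂|s₂² − s₀²| + W₃|s₃² − s₀²|`. [folklore] -/
theorem dev_bound (W₀ W₁ W₂ W₃ s₀ s₁ s₂ s₃ τ : ℝ) (h0 : 0 ≤ W₀) (h1 : 0 ≤ W₁) (h2 : 0 ≤ W₂) (h3 : 0 ≤ W₃)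
    (h : (W₀ + W₁ + W₂ + W₃) * τ ^ 2 = W₀ * s₀ ^ 2 + W₁ * s₁ ^ 2 + W₂ * s₂ ^ 2 + W₃ * s₃ ^ 2) :
    (W₀ + W₁ + W₂ + W₃) * |τ ^ 2 - s₀ ^ 2| ≤ W₁ * |s₁ ^ 2 - s₀ ^ 2| + W₂ * |s₂ ^ 2 - s₀ ^ 2| + W₃ * |s₃ ^ 2 - s₀ ^ 2| := by
  have hdev : (W₀ + W₁ + W₂ + W₃) * (τ ^ 2 - s₀ ^ 2)
      = W₁ * (s₁ ^ 2 - s₀ ^ 2) + W₂ * (s₂ ^ 2 - s₀ ^ 2) + W₃ * (s₃ ^ 2 - s₀ ^ 2) := by linear_combination h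
  have hA : 0 ≤ W₀ + W₁ + W₂ + W₃ := by positivity
  rw [← abs_of_nonneg hA, ← abs_mul, hdev]
  have e1 : |W₁ * (s₁ ^ 2 - s₀ ^ 2)| = W₁ * |s₁ ^ 2 - s₀ ^ 2| := by rw [abs_mul, abs_of_nonneg h1]
  have e2 : |W₂ * (s₂ ^ 2 - s₀ ^ 2)| = W₂ * |s₂ ^ 2 - s₀ ^ 2| := by rw [abs_mul, abs_of_nonneg h2]
  have e3 : |W₃ * (s₃ ^ 2 - s₀ ^ 2)| = W₃ * |s₃ ^ 2 - s₀ ^ 2| := by rw [abs_mul, abs_of_nonneg h3]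
  have := abs_add_le (W₁ * (s₁ ^ 2 - s₀ ^ 2) + W₂ * (s₂ ^ 2 - s₀ ^ 2)) (W₃ * (s₃ ^ 2 - s₀ ^ 2))
  have := abs_add_le (W₁ * (s₁ ^ 2 - s₀ ^ 2)) (W₂ * (s₂ ^ 2 - s₀ ^ 2))
  linarith

/-- `|τ − s|·s ≤ |τ² − s²|` for `τ, s > 0`. [folklore] -/
theorem abs_sub_mul_le (τ s : ℝ) (hτ : 0 < τ) (hs : 0 < s) : |τ - s| * s ≤ |τ ^ 2 - s ^ 2| := by
  rw [sq_sub_sq, abs_mul, abs_of_pos (by linarith : 0 < τ + s)]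
  calc |τ - s| * s ≤ |τ - s| * (τ + s) := mul_le_mul_of_nonneg_left (by linarith) (abs_nonneg _)
    _ = (τ + s) * |τ - s| := by ring

/-- A point within half the distance `|a − b|` of `a` is at least `|a − b|/2` from `b` (squared form). [folklore] -/
theorem quarter_sq_le (τ a b : ℝ) (h : |τ - a| ≤ |a - b| / 2) : (a - b) ^ 2 / 4 ≤ (τ - b) ^ 2 := by
  have htri : |a - b| ≤ |τ - a| + |τ - b| := by
    calc |a - b| = |(τ - b) - (τ - a)| := by ring_nf
      _ ≤ |τ - b| + |τ - a| := abs_sub _ _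
      _ = |τ - a| + |τ - b| := by ring
  have hge : |a - b| / 2 ≤ |τ - b| := by linarith
  calc (a - b) ^ 2 / 4 = (|a - b| / 2) ^ 2 := by rw [div_pow, sq_abs]; ring
    _ ≤ |τ - b| ^ 2 := pow_le_pow_left₀ (by positivity) hge 2
    _ = (τ - b) ^ 2 := sq_abs _

/-! ## 1. Near `0⁺`: the dent of letter `1` wins -/

/-- **SIGNED DENT SUM POSITIVE NEAR `0⁺` (`1|3`).**  Four letters with positive weights and positions, exponents `d₀ < e < d₁ ≤ d₂`, `d₁ ≤ d₃`,
letters `0, 1` not parallel.  There is `a > 0` such that for every `0 < x ≤ a` and every direction `τ > 0` with `A τ² = C`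
(i.e. `τ = T̂(x)`): `0 < ∑ₖ (dₖ − e)·wₖx^{dₖ}·(τ − tₖ)²` — letter `1`'s dent `≥ |t₀−t₁|²/4` at weight `x^{d₁}` beats letter `0`'s dent
`O(x^{2(d₁−d₀)})` at weight `x^{d₀}`. [this file] -/
theorem signedDent_pos_near_zero (w t : Fin 4 → ℝ) (d : Fin 4 → ℕ) (e : ℕ)
    (hw : ∀ k, 0 < w k) (ht : ∀ k, 0 < t k) (h01 : t 0 ≠ t 1)
    (h0e : d 0 < e) (he1 : e < d 1) (h12 : d 1 ≤ d 2) (h13 : d 1 ≤ d 3) :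
    ∃ a, 0 < a ∧ ∀ x, 0 < x → x ≤ a → ∀ τ, 0 < τ →
      (∑ k, w k * x ^ d k) * τ ^ 2 = ∑ k, w k * t k ^ 2 * x ^ d k →
      0 < ∑ k, ((d k : ℝ) - e) * (w k * x ^ d k) * (τ - t k) ^ 2 := by
  have hw0 := hw 0; have hw1 := hw 1; have hw2 := hw 2; have hw3 := hw 3
  have ht0 := ht 0; have ht1 := ht 1
  set M : ℝ := w 1 * |t 1 ^ 2 - t 0 ^ 2| + w 2 * |t 2 ^ 2 - t 0 ^ 2| + w 3 * |t 3 ^ 2 - t 0 ^ 2| with hM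
  set D : ℝ := |t 0 - t 1| with hD
  have hDpos : 0 < D := abs_pos.2 (sub_ne_zero.2 h01)
  have hsq01 : t 1 ^ 2 - t 0 ^ 2 ≠ 0 := by
    rw [sq_sub_sq]; exact mul_ne_zero (by linarith) (sub_ne_zero.2 (Ne.symm h01))
  have hMpos : 0 < M := by
    have h1 : 0 < w 1 * |t 1 ^ 2 - t 0 ^ 2| := mul_pos hw1 (abs_pos.2 hsq01)
    have h2 : 0 ≤ w 2 * |t 2 ^ 2 - t 0 ^ 2| := by positivity
    have h3 : 0 ≤ w 3 * |t 3 ^ 2 - t 0 ^ 2| := by positivity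
    linarith
  have hed0 : (0 : ℝ) < (e : ℝ) - d 0 := sub_pos.2 (by exact_mod_cast h0e)
  have hd1e : (0 : ℝ) < (d 1 : ℝ) - e := sub_pos.2 (by exact_mod_cast he1)
  set κ : ℝ := ((d 1 : ℝ) - e) * w 1 * D ^ 2 * w 0 * t 0 ^ 2 / (4 * ((e : ℝ) - d 0) * M ^ 2) with hκ
  have hκpos : 0 < κ := by rw [hκ]; positivity
  set a : ℝ := min 1 (min (D * t 0 * w 0 / (2 * M)) (κ / 2)) with ha
  have ha1 : a ≤ 1 := min_le_left _ _
  have ha2 : a ≤ D * t 0 * w 0 / (2 * M) := le_trans (min_le_right _ _) (min_le_left _ _)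
  have ha3 : a ≤ κ / 2 := le_trans (min_le_right _ _) (min_le_right _ _)
  refine ⟨a, by rw [ha]; positivity, ?_⟩
  intro x hx hxa τ hτ hAC
  have hx1 : x ≤ 1 := hxa.trans ha1
  set P := x ^ d 0 with hP
  set Q := x ^ d 1 with hQ
  have hPpos : 0 < P := pow_pos hx _
  have hQpos : 0 < Q := pow_pos hx _
  have hQ2 : x ^ d 2 ≤ Q := pow_le_pow_of_le_one hx.le hx1 h12
  have hQ3 : x ^ d 3 ≤ Q := pow_le_pow_of_le_one hx.le hx1 h13
  have hQP : Q ≤ x * P := by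
    have h : x ^ d 1 ≤ x ^ (d 0 + 1) := pow_le_pow_of_le_one hx.le hx1 (by omega)
    rw [pow_succ] at h
    rw [hQ, hP]; linarith
  simp only [Fin.sum_univ_four] at hAC ⊢
  rw [← hP, ← hQ] at hAC ⊢
  -- deviation of `τ` from `t₀`: `|τ − t₀|·(w₀ P t₀) ≤ Q·M`
  have hA_ge : w 0 * P ≤ w 0 * P + w 1 * Q + w 2 * x ^ d 2 + w 3 * x ^ d 3 := by
    have : 0 ≤ w 1 * Q := by positivity
    have : 0 ≤ w 2 * x ^ d 2 := by positivity
    have : 0 ≤ w 3 * x ^ d 3 := by positivity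
    linarith
  have hdevb := dev_bound (w 0 * P) (w 1 * Q) (w 2 * x ^ d 2) (w 3 * x ^ d 3) (t 0) (t 1) (t 2) (t 3) τ
    (by positivity) (by positivity) (by positivity) (by positivity) (by linear_combination hAC)
  have hRM : w 1 * Q * |t 1 ^ 2 - t 0 ^ 2| + w 2 * x ^ d 2 * |t 2 ^ 2 - t 0 ^ 2| + w 3 * x ^ d 3 * |t 3 ^ 2 - t 0 ^ 2|
      ≤ Q * M := by
    have a2 : w 2 * x ^ d 2 * |t 2 ^ 2 - t 0 ^ 2| ≤ w 2 * Q * |t 2 ^ 2 - t 0 ^ 2| :=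
      mul_le_mul_of_nonneg_right (mul_le_mul_of_nonneg_left hQ2 hw2.le) (abs_nonneg _)
    have a3 : w 3 * x ^ d 3 * |t 3 ^ 2 - t 0 ^ 2| ≤ w 3 * Q * |t 3 ^ 2 - t 0 ^ 2| :=
      mul_le_mul_of_nonneg_right (mul_le_mul_of_nonneg_left hQ3 hw3.le) (abs_nonneg _)
    have e : w 1 * Q * |t 1 ^ 2 - t 0 ^ 2| + w 2 * Q * |t 2 ^ 2 - t 0 ^ 2| + w 3 * Q * |t 3 ^ 2 - t 0 ^ 2| = Q * M := by
      rw [hM]; ring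
    linarith
  have hkey : |τ - t 0| * (w 0 * P * t 0) ≤ Q * M := by
    have h2 : |τ ^ 2 - t 0 ^ 2| * (w 0 * P) ≤ Q * M := by
      have := mul_le_mul_of_nonneg_left hA_ge (abs_nonneg (τ ^ 2 - t 0 ^ 2))
      linarith
    calc |τ - t 0| * (w 0 * P * t 0) = (|τ - t 0| * t 0) * (w 0 * P) := by ring
      _ ≤ |τ ^ 2 - t 0 ^ 2| * (w 0 * P) := mul_le_mul_of_nonneg_right (abs_sub_mul_le τ (t 0) hτ ht0) (by positivity)
      _ ≤ Q * M := h2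
  -- `|τ − t₀| ≤ D/2`, hence the dent of letter 1 is at least `D²/4`
  have hxa2 : 2 * M * x ≤ D * t 0 * w 0 := by
    have := (le_div_iff₀ (by positivity : (0 : ℝ) < 2 * M)).1 (hxa.trans ha2)
    linarith
  have hdev0 : |τ - t 0| ≤ |t 0 - t 1| / 2 := by
    have h : |τ - t 0| * (w 0 * P * t 0) ≤ (D / 2) * (w 0 * P * t 0) := by
      calc |τ - t 0| * (w 0 * P * t 0) ≤ Q * M := hkey
        _ ≤ x * P * M := mul_le_mul_of_nonneg_right hQP hMpos.le
        _ = (2 * M * x) * P / 2 := by ring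
        _ ≤ (D * t 0 * w 0) * P / 2 := by
            have := mul_le_mul_of_nonneg_right hxa2 hPpos.le
            linarith
        _ = (D / 2) * (w 0 * P * t 0) := by ring
    exact le_of_mul_le_mul_right h (by positivity)
  have hdent1 : D ^ 2 / 4 ≤ (τ - t 1) ^ 2 := by
    have h := quarter_sq_le τ (t 0) (t 1) hdev0
    rwa [← sq_abs (t 0 - t 1), ← hD] at h
  -- the negative term against `(Q M)²`, the positive term of letter 1, the threshold `x < κ`
  have hneg : ((e : ℝ) - d 0) * (w 0 * P) * (τ - t 0) ^ 2 * (w 0 * P * t 0 ^ 2) ≤ ((e : ℝ) - d 0) * (Q * M) ^ 2 := by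
    have hsq : (|τ - t 0| * (w 0 * P * t 0)) ^ 2 ≤ (Q * M) ^ 2 := pow_le_pow_left₀ (by positivity) hkey 2
    have e1 : ((e : ℝ) - d 0) * (w 0 * P) * (τ - t 0) ^ 2 * (w 0 * P * t 0 ^ 2)
        = ((e : ℝ) - d 0) * (|τ - t 0| * (w 0 * P * t 0)) ^ 2 := by rw [mul_pow, sq_abs]; ring
    rw [e1]
    exact mul_le_mul_of_nonneg_left hsq hed0.le
  have hpos1 : ((d 1 : ℝ) - e) * (w 1 * Q) * (D ^ 2 / 4) ≤ ((d 1 : ℝ) - e) * (w 1 * Q) * (τ - t 1) ^ 2 :=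
    mul_le_mul_of_nonneg_left hdent1 (by positivity)
  have hxκ : x * (4 * ((e : ℝ) - d 0) * M ^ 2) < ((d 1 : ℝ) - e) * w 1 * D ^ 2 * w 0 * t 0 ^ 2 := by
    have hlt : x < κ := lt_of_le_of_lt (hxa.trans ha3) (by linarith)
    rw [hκ, lt_div_iff₀ (by positivity)] at hlt
    exact hlt
  have hmain : ((e : ℝ) - d 0) * (w 0 * P) * (τ - t 0) ^ 2 < ((d 1 : ℝ) - e) * (w 1 * Q) * (τ - t 1) ^ 2 := by
    have hc : 0 < w 0 * P * t 0 ^ 2 := by positivity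
    have h1 : ((e : ℝ) - d 0) * (Q * M) ^ 2 ≤ ((e : ℝ) - d 0) * M ^ 2 * Q * (x * P) := by
      have : ((e : ℝ) - d 0) * (Q * M) ^ 2 = (((e : ℝ) - d 0) * M ^ 2 * Q) * Q := by ring
      rw [this]
      exact mul_le_mul_of_nonneg_left hQP (by positivity)
    have hxκ' : x * (((e : ℝ) - d 0) * M ^ 2) < ((d 1 : ℝ) - e) * w 1 * D ^ 2 * w 0 * t 0 ^ 2 / 4 := by linarith [hxκ]
    have h2' := mul_lt_mul_of_pos_left hxκ' (mul_pos hQpos hPpos)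
    have h2 : ((e : ℝ) - d 0) * M ^ 2 * Q * (x * P) < ((d 1 : ℝ) - e) * (w 1 * Q) * (D ^ 2 / 4) * (w 0 * P * t 0 ^ 2) := by
      calc ((e : ℝ) - d 0) * M ^ 2 * Q * (x * P) = Q * P * (x * (((e : ℝ) - d 0) * M ^ 2)) := by ring
        _ < Q * P * (((d 1 : ℝ) - e) * w 1 * D ^ 2 * w 0 * t 0 ^ 2 / 4) := h2'
        _ = ((d 1 : ℝ) - e) * (w 1 * Q) * (D ^ 2 / 4) * (w 0 * P * t 0 ^ 2) := by ring
    have h3 := lt_of_le_of_lt hneg (lt_of_le_of_lt h1 h2)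
    have h4 := mul_le_mul_of_nonneg_right hpos1 hc.le
    exact lt_of_mul_lt_mul_right (lt_of_lt_of_le h3 h4) hc.le
  -- the remaining two terms are non-negative
  have h2nn : 0 ≤ ((d 2 : ℝ) - e) * (w 2 * x ^ d 2) * (τ - t 2) ^ 2 := by
    have : (0 : ℝ) ≤ (d 2 : ℝ) - e := sub_nonneg.2 (by exact_mod_cast (by omega : e ≤ d 2))
    positivity
  have h3nn : 0 ≤ ((d 3 : ℝ) - e) * (w 3 * x ^ d 3) * (τ - t 3) ^ 2 := by
    have : (0 : ℝ) ≤ (d 3 : ℝ) - e := sub_nonneg.2 (by exact_mod_cast (by omega : e ≤ d 3))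
    positivity
  have e0 : ((d 0 : ℝ) - e) * (w 0 * P) * (τ - t 0) ^ 2 = -(((e : ℝ) - d 0) * (w 0 * P) * (τ - t 0) ^ 2) := by ring
  linarith [hmain, h2nn, h3nn, e0]

/-! ## 2. Near `∞`: the dent of letter `2` wins -/

/-- **SIGNED DENT SUM POSITIVE NEAR `∞` (`1|3`).**  Four letters with positive weights and positions, exponents `d₀ < e ≤ d₁ ≤ d₂ < d₃`,
`e < d₂`, letters `2, 3` not parallel.  There is `b > 0` such that for every `x ≥ b` and every direction `τ > 0` with `A τ² = C`:
`0 < ∑ₖ (dₖ − e)·wₖx^{dₖ}·(τ − tₖ)²` — letter `2`'s dent `≥ |t₂−t₃|²/4` at weight `x^{d₂}` beats letter `0`'s bounded dent at weight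
`x^{d₀}` (`τ² ≤ Σ tₖ²`). [this file] -/
theorem signedDent_pos_near_infty (w t : Fin 4 → ℝ) (d : Fin 4 → ℕ) (e : ℕ)
    (hw : ∀ k, 0 < w k) (ht : ∀ k, 0 < t k) (h23 : t 2 ≠ t 3)
    (h0e : d 0 < e) (he1 : e ≤ d 1) (h12 : d 1 ≤ d 2) (he2 : e < d 2) (hd23 : d 2 < d 3) :
    ∃ b, 0 < b ∧ ∀ x, b ≤ x → ∀ τ, 0 < τ →
      (∑ k, w k * x ^ d k) * τ ^ 2 = ∑ k, w k * t k ^ 2 * x ^ d k →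
      0 < ∑ k, ((d k : ℝ) - e) * (w k * x ^ d k) * (τ - t k) ^ 2 := by
  have hw0 := hw 0; have hw1 := hw 1; have hw2 := hw 2; have hw3 := hw 3
  have ht0 := ht 0; have ht2 := ht 2; have ht3 := ht 3
  set M : ℝ := w 0 * |t 0 ^ 2 - t 3 ^ 2| + w 1 * |t 1 ^ 2 - t 3 ^ 2| + w 2 * |t 2 ^ 2 - t 3 ^ 2| with hM
  have hMnn : 0 ≤ M := by positivity
  set D : ℝ := |t 3 - t 2| with hD
  have hDpos : 0 < D := abs_pos.2 (sub_ne_zero.2 (Ne.symm h23))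
  set Θ : ℝ := 2 * (t 0 ^ 2 + t 1 ^ 2 + t 2 ^ 2 + t 3 ^ 2) + 2 * t 0 ^ 2 with hΘ
  have hΘpos : 0 < Θ := by positivity
  have hed0 : (0 : ℝ) < (e : ℝ) - d 0 := sub_pos.2 (by exact_mod_cast h0e)
  have hd2e : (0 : ℝ) < (d 2 : ℝ) - e := sub_pos.2 (by exact_mod_cast he2)
  set b : ℝ := max 1 (max (2 * M / (D * w 3 * t 3)) (4 * ((e : ℝ) - d 0) * w 0 * Θ / (((d 2 : ℝ) - e) * w 2 * D ^ 2) + 1))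
    with hb
  have hb1 : 1 ≤ b := le_max_left _ _
  have hb2 : 2 * M / (D * w 3 * t 3) ≤ b := le_trans (le_max_left _ _) (le_max_right _ _)
  have hb3 : 4 * ((e : ℝ) - d 0) * w 0 * Θ / (((d 2 : ℝ) - e) * w 2 * D ^ 2) + 1 ≤ b :=
    le_trans (le_max_right _ _) (le_max_right _ _)
  refine ⟨b, lt_of_lt_of_le one_pos hb1, ?_⟩
  intro x hbx τ hτ hAC
  have hx1 : 1 ≤ x := hb1.trans hbx
  have hx : 0 < x := lt_of_lt_of_le one_pos hx1
  set P := x ^ d 0 with hP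
  set R := x ^ d 2 with hR
  set S := x ^ d 3 with hS
  have hPpos : 0 < P := pow_pos hx _
  have hRpos : 0 < R := pow_pos hx _
  have hSpos : 0 < S := pow_pos hx _
  have hR0 : P ≤ R := pow_le_pow_right₀ hx1 (by omega)
  have hR1 : x ^ d 1 ≤ R := pow_le_pow_right₀ hx1 h12
  have hSR : x * R ≤ S := by
    have h : x ^ (d 2 + 1) ≤ x ^ d 3 := pow_le_pow_right₀ hx1 (by omega)
    rw [pow_succ] at h
    rw [hR, hS]; linarith
  have hRP : x * P ≤ R := by
    have h : x ^ (d 0 + 1) ≤ x ^ d 2 := pow_le_pow_right₀ hx1 (by omega)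
    rw [pow_succ] at h
    rw [hR, hP]; linarith
  simp only [Fin.sum_univ_four] at hAC ⊢
  rw [← hP, ← hR, ← hS] at hAC ⊢
  have hA_ge : w 3 * S ≤ w 3 * S + w 0 * P + w 1 * x ^ d 1 + w 2 * R := by
    have : 0 ≤ w 0 * P := by positivity
    have : 0 ≤ w 1 * x ^ d 1 := by positivity
    have : 0 ≤ w 2 * R := by positivity
    linarith
  -- deviation of `τ` from `t₃`: `|τ − t₃|·(w₃ S t₃) ≤ R·M`
  have hdevb := dev_bound (w 3 * S) (w 0 * P) (w 1 * x ^ d 1) (w 2 * R) (t 3) (t 0) (t 1) (t 2) τ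
    (by positivity) (by positivity) (by positivity) (by positivity) (by linear_combination hAC)
  have hRM : w 0 * P * |t 0 ^ 2 - t 3 ^ 2| + w 1 * x ^ d 1 * |t 1 ^ 2 - t 3 ^ 2| + w 2 * R * |t 2 ^ 2 - t 3 ^ 2| ≤ R * M := by
    have a0 : w 0 * P * |t 0 ^ 2 - t 3 ^ 2| ≤ w 0 * R * |t 0 ^ 2 - t 3 ^ 2| :=
      mul_le_mul_of_nonneg_right (mul_le_mul_of_nonneg_left hR0 hw0.le) (abs_nonneg _)
    have a1 : w 1 * x ^ d 1 * |t 1 ^ 2 - t 3 ^ 2| ≤ w 1 * R * |t 1 ^ 2 - t 3 ^ 2| :=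
      mul_le_mul_of_nonneg_right (mul_le_mul_of_nonneg_left hR1 hw1.le) (abs_nonneg _)
    have e : w 0 * R * |t 0 ^ 2 - t 3 ^ 2| + w 1 * R * |t 1 ^ 2 - t 3 ^ 2| + w 2 * R * |t 2 ^ 2 - t 3 ^ 2| = R * M := by
      rw [hM]; ring
    linarith
  have hkey : |τ - t 3| * (w 3 * S * t 3) ≤ R * M := by
    have h2 : |τ ^ 2 - t 3 ^ 2| * (w 3 * S) ≤ R * M := by
      have := mul_le_mul_of_nonneg_left hA_ge (abs_nonneg (τ ^ 2 - t 3 ^ 2))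
      linarith
    calc |τ - t 3| * (w 3 * S * t 3) = (|τ - t 3| * t 3) * (w 3 * S) := by ring
      _ ≤ |τ ^ 2 - t 3 ^ 2| * (w 3 * S) := mul_le_mul_of_nonneg_right (abs_sub_mul_le τ (t 3) hτ ht3) (by positivity)
      _ ≤ R * M := h2
  -- `|τ − t₃| ≤ D/2`, hence the dent of letter 2 is at least `D²/4`
  have hxb2 : 2 * M ≤ D * w 3 * t 3 * x := by
    have := (div_le_iff₀ (by positivity : (0 : ℝ) < D * w 3 * t 3)).1 (hb2.trans hbx)
    linarith
  have hdev3 : |τ - t 3| ≤ |t 3 - t 2| / 2 := by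
    have h : |τ - t 3| * (w 3 * S * t 3) ≤ (D / 2) * (w 3 * S * t 3) := by
      calc |τ - t 3| * (w 3 * S * t 3) ≤ R * M := hkey
        _ = (2 * M) * R / 2 := by ring
        _ ≤ (D * w 3 * t 3 * x) * R / 2 := by
            have := mul_le_mul_of_nonneg_right hxb2 hRpos.le
            linarith
        _ = (D / 2) * (w 3 * t 3) * (x * R) := by ring
        _ ≤ (D / 2) * (w 3 * t 3) * S := mul_le_mul_of_nonneg_left hSR (by positivity)
        _ = (D / 2) * (w 3 * S * t 3) := by ring
    exact le_of_mul_le_mul_right h (by positivity)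
  have hdent2 : D ^ 2 / 4 ≤ (τ - t 2) ^ 2 := by
    have h := quarter_sq_le τ (t 3) (t 2) hdev3
    rwa [← sq_abs (t 3 - t 2), ← hD] at h
  -- the negative term is at most `(e − d₀)·w₀·Θ·P`: `τ² ≤ Σ tₖ²`, so `(τ − t₀)² ≤ Θ`
  have hτsq : τ ^ 2 ≤ t 0 ^ 2 + t 1 ^ 2 + t 2 ^ 2 + t 3 ^ 2 := by
    have p0 : 0 ≤ w 0 * P := by positivity
    have p1 : 0 ≤ w 1 * x ^ d 1 := by positivity
    have p2 : 0 ≤ w 2 * R := by positivity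
    have p3 : 0 ≤ w 3 * S := by positivity
    have q0 := mul_nonneg p0 (add_nonneg (add_nonneg (sq_nonneg (t 1)) (sq_nonneg (t 2))) (sq_nonneg (t 3)))
    have q1 := mul_nonneg p1 (add_nonneg (add_nonneg (sq_nonneg (t 0)) (sq_nonneg (t 2))) (sq_nonneg (t 3)))
    have q2 := mul_nonneg p2 (add_nonneg (add_nonneg (sq_nonneg (t 0)) (sq_nonneg (t 1))) (sq_nonneg (t 3)))
    have q3 := mul_nonneg p3 (add_nonneg (add_nonneg (sq_nonneg (t 0)) (sq_nonneg (t 1))) (sq_nonneg (t 2)))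
    have hA0 : 0 < w 0 * P + w 1 * x ^ d 1 + w 2 * R + w 3 * S := by positivity
    by_contra hlt
    push Not at hlt
    have h1 := mul_lt_mul_of_pos_right hlt hA0
    have key : (t 0 ^ 2 + t 1 ^ 2 + t 2 ^ 2 + t 3 ^ 2) * (w 0 * P + w 1 * x ^ d 1 + w 2 * R + w 3 * S)
        = (w 0 * P + w 1 * x ^ d 1 + w 2 * R + w 3 * S) * τ ^ 2
          + (w 0 * P * (t 1 ^ 2 + t 2 ^ 2 + t 3 ^ 2) + w 1 * x ^ d 1 * (t 0 ^ 2 + t 2 ^ 2 + t 3 ^ 2)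
          + w 2 * R * (t 0 ^ 2 + t 1 ^ 2 + t 3 ^ 2) + w 3 * S * (t 0 ^ 2 + t 1 ^ 2 + t 2 ^ 2)) := by
      rw [hAC]; ring
    linarith [key, q0, q1, q2, q3, h1]
  have hneg0 : (τ - t 0) ^ 2 ≤ Θ := by
    have hsq : (τ - t 0) ^ 2 = 2 * τ ^ 2 + 2 * t 0 ^ 2 - (τ + t 0) ^ 2 := by ring
    rw [hΘ, hsq]; linarith [sq_nonneg (τ + t 0), hτsq, sq_nonneg (t 1), sq_nonneg (t 2), sq_nonneg (t 3)]
  have hneg : ((e : ℝ) - d 0) * (w 0 * P) * (τ - t 0) ^ 2 ≤ ((e : ℝ) - d 0) * w 0 * Θ * P := by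
    have := mul_le_mul_of_nonneg_left hneg0 (by positivity : (0 : ℝ) ≤ ((e : ℝ) - d 0) * (w 0 * P))
    linarith [this]
  -- the positive term of letter 2 and the threshold
  have hpos2 : ((d 2 : ℝ) - e) * (w 2 * R) * (D ^ 2 / 4) ≤ ((d 2 : ℝ) - e) * (w 2 * R) * (τ - t 2) ^ 2 :=
    mul_le_mul_of_nonneg_left hdent2 (by positivity)
  have hxb3 : 4 * ((e : ℝ) - d 0) * w 0 * Θ < ((d 2 : ℝ) - e) * w 2 * D ^ 2 * x := by
    have hlt : 4 * ((e : ℝ) - d 0) * w 0 * Θ / (((d 2 : ℝ) - e) * w 2 * D ^ 2) < x := by linarith [hb3.trans hbx]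
    have := (div_lt_iff₀ (by positivity : (0 : ℝ) < ((d 2 : ℝ) - e) * w 2 * D ^ 2)).1 hlt
    linarith
  have hmain : ((e : ℝ) - d 0) * (w 0 * P) * (τ - t 0) ^ 2 < ((d 2 : ℝ) - e) * (w 2 * R) * (τ - t 2) ^ 2 := by
    have step : ((e : ℝ) - d 0) * w 0 * Θ * P < ((d 2 : ℝ) - e) * (w 2 * R) * (D ^ 2 / 4) := by
      have h1 := mul_lt_mul_of_pos_right hxb3 hPpos
      have h2 : ((d 2 : ℝ) - e) * w 2 * D ^ 2 * x * P ≤ ((d 2 : ℝ) - e) * w 2 * D ^ 2 * R := by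
        have := mul_le_mul_of_nonneg_left hRP (by positivity : (0 : ℝ) ≤ ((d 2 : ℝ) - e) * w 2 * D ^ 2)
        linarith [this]
      have e1 : ((d 2 : ℝ) - e) * (w 2 * R) * (D ^ 2 / 4) = (((d 2 : ℝ) - e) * w 2 * D ^ 2 * R) / 4 := by ring
      rw [e1]; linarith [h1, h2]
    calc ((e : ℝ) - d 0) * (w 0 * P) * (τ - t 0) ^ 2 ≤ ((e : ℝ) - d 0) * w 0 * Θ * P := hneg
      _ < ((d 2 : ℝ) - e) * (w 2 * R) * (D ^ 2 / 4) := step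
      _ ≤ ((d 2 : ℝ) - e) * (w 2 * R) * (τ - t 2) ^ 2 := hpos2
  -- the remaining two terms are non-negative
  have h1nn : 0 ≤ ((d 1 : ℝ) - e) * (w 1 * x ^ d 1) * (τ - t 1) ^ 2 := by
    have : (0 : ℝ) ≤ (d 1 : ℝ) - e := sub_nonneg.2 (by exact_mod_cast he1)
    positivity
  have h3nn : 0 ≤ ((d 3 : ℝ) - e) * (w 3 * S) * (τ - t 3) ^ 2 := by
    have : (0 : ℝ) ≤ (d 3 : ℝ) - e := sub_nonneg.2 (by exact_mod_cast (by omega : e ≤ d 3))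
    positivity
  have e0 : ((d 0 : ℝ) - e) * (w 0 * P) * (τ - t 0) ^ 2 = -(((e : ℝ) - d 0) * (w 0 * P) * (τ - t 0) ^ 2) := by ring
  linarith [hmain, h1nn, h3nn, e0]

/-! ## 3. End values of the e-free exponent profile `E` (the currency of `…CriticalWindowsTurning`) -/

/-- The numerator minus `e` times the denominator of `E` is the signed dent sum. [folklore] -/
theorem profile_num_sub (w t : Fin 4 → ℝ) (d : Fin 4 → ℕ) (e : ℕ) (x τ : ℝ) :
    (∑ k, (d k : ℝ) * (w k * x ^ d k) * (τ - t k) ^ 2) - (e : ℝ) * ∑ k, w k * x ^ d k * (τ - t k) ^ 2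
      = ∑ k, ((d k : ℝ) - e) * (w k * x ^ d k) * (τ - t k) ^ 2 := by
  rw [Finset.mul_sum, ← Finset.sum_sub_distrib]
  exact Finset.sum_congr rfl fun k _ => by ring

/-- **`E > e` NEAR `0⁺` ON THE `1|3` SPLIT.**  `d₀ < e < d₁ ≤ d₂`, `d₁ ≤ d₃`, positive weights and positions, letters `0, 1` not parallel:
there is `a > 0` with `e < E(x)` for all `0 < x ≤ a`, `E` the e-free exponent profile of `…CriticalWindowsTurning` (dent mean of the
exponents at the optimal direction `T̂ = √(C/A)`).  (Located value: `E(0⁺) = d₁`.) [this file] -/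
theorem profile_gt_near_zero (w t : Fin 4 → ℝ) (d : Fin 4 → ℕ) (e : ℕ)
    (hw : ∀ k, 0 < w k) (ht : ∀ k, 0 < t k) (h01 : t 0 ≠ t 1)
    (h0e : d 0 < e) (he1 : e < d 1) (h12 : d 1 ≤ d 2) (h13 : d 1 ≤ d 3) :
    ∃ a, 0 < a ∧ ∀ x, 0 < x → x ≤ a →
      (e : ℝ) < (∑ k, (d k : ℝ) * (w k * x ^ d k)
          * (Real.sqrt ((∑ l, w l * t l ^ 2 * x ^ d l) / (∑ l, w l * x ^ d l)) - t k) ^ 2)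
        / (∑ k, w k * x ^ d k
          * (Real.sqrt ((∑ l, w l * t l ^ 2 * x ^ d l) / (∑ l, w l * x ^ d l)) - t k) ^ 2) := by
  obtain ⟨a, ha, h⟩ := signedDent_pos_near_zero w t d e hw ht h01 h0e he1 h12 h13
  refine ⟨a, ha, fun x hx hxa => ?_⟩
  set τ := Real.sqrt ((∑ l, w l * t l ^ 2 * x ^ d l) / (∑ l, w l * x ^ d l)) with hτ
  obtain ⟨hτpos, hτC⟩ := optDir_pos_sq (Finset.univ : Finset (Fin 4)) ⟨0, Finset.mem_univ _⟩ w t d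
    (fun m _ => hw m) (fun m _ => ht m) hx
  have hZ := dent_pos (Finset.univ : Finset (Fin 4)) w t d (fun m _ => hw m) (Finset.mem_univ 0) (Finset.mem_univ 1)
    h01 hx τ
  have hN := h x hx hxa τ hτpos hτC
  rw [lt_div_iff₀ hZ]
  have := profile_num_sub w t d e x τ
  linarith

/-- **`E > e` NEAR `∞` ON THE `1|3` SPLIT.**  `d₀ < e ≤ d₁ ≤ d₂ < d₃`, `e < d₂`, positive weights and positions, letters `2, 3` not
parallel and letters `0, 1` not parallel (the latter only to make `E` well defined): there is `b > 0` with `e < E(x)` for all `x ≥ b`.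
(Located value: `E(∞) = d₂`.) [this file] -/
theorem profile_gt_near_infty (w t : Fin 4 → ℝ) (d : Fin 4 → ℕ) (e : ℕ)
    (hw : ∀ k, 0 < w k) (ht : ∀ k, 0 < t k) (h01 : t 0 ≠ t 1) (h23 : t 2 ≠ t 3)
    (h0e : d 0 < e) (he1 : e ≤ d 1) (h12 : d 1 ≤ d 2) (he2 : e < d 2) (hd23 : d 2 < d 3) :
    ∃ b, 0 < b ∧ ∀ x, b ≤ x →
      (e : ℝ) < (∑ k, (d k : ℝ) * (w k * x ^ d k)
          * (Real.sqrt ((∑ l, w l * t l ^ 2 * x ^ d l) / (∑ l, w l * x ^ d l)) - t k) ^ 2)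
        / (∑ k, w k * x ^ d k
          * (Real.sqrt ((∑ l, w l * t l ^ 2 * x ^ d l) / (∑ l, w l * x ^ d l)) - t k) ^ 2) := by
  obtain ⟨b, hb, h⟩ := signedDent_pos_near_infty w t d e hw ht h23 h0e he1 h12 he2 hd23
  refine ⟨b, hb, fun x hbx => ?_⟩
  have hx : 0 < x := lt_of_lt_of_le hb hbx
  set τ := Real.sqrt ((∑ l, w l * t l ^ 2 * x ^ d l) / (∑ l, w l * x ^ d l)) with hτ
  obtain ⟨hτpos, hτC⟩ := optDir_pos_sq (Finset.univ : Finset (Fin 4)) ⟨0, Finset.mem_univ _⟩ w t d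
    (fun m _ => hw m) (fun m _ => ht m) hx
  have hZ := dent_pos (Finset.univ : Finset (Fin 4)) w t d (fun m _ => hw m) (Finset.mem_univ 0) (Finset.mem_univ 1)
    h01 hx τ
  have hN := h x hbx τ hτpos hτC
  rw [lt_div_iff₀ hZ]
  have := profile_num_sub w t d e x τ
  linarith

end Summit.ValiantsHypothesis.ValiantsHypothesis.Theorems.LacunarySymmetroidMatrixDescartes.Pivot.CriticalWindows.TurningEnds
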